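import Summits.QuantumFields.BalabanUV.T4Continuum.Support.NE7HintOfSliceNormalisationSU2Dec
import Summits.QuantumFields.BalabanUV.T4Continuum.Support.NE7HdecompOfTopNormalised
import HarnessLib

/-!
# Support | NE7 (gen 98, END OF RECORD RE-ISSUED OVER ROAD-Γ′): `hint_SU2_of_topNormalised` — gen 95's END `NE7HintOfSliceNormalisationSU2Dec.hint_SU2_of_decomposition` with its
# per-pair binder `hdecomp♭` REPLACED by the two suppliers of ROAD-Γ′: (A) a TOP-NORMALISED representative of every admissible pair (corner-trivial unitary gauge, trivial accumulated
# top frame `v_{k+1} ≡ 1`, `sup‖X‖·M ≤ α̂`) and (B) the three k-free MASSES `(m₂, p₂, m₁)` of leaf-02's slice-correcting generator of the tangent residual; plus four explicit k-free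
# lines on `α̂` and the two displayed ceiling lines `ν(α̂, ε, m₂, p₂) ≤ ν̂`, `κ(ε, m₁) ≤ κ̂`

Cell `pub-balaban`, rung (B)+1 sub-cell t4, lineage `b2b-balaban-t4-ne7-p1` (CRUX PROVER NE7 #1 = OWNER of row NE7), generation 98; memo `t4/b2b-balaban-t4-ne7-p1-g98/ROAD-G98.md` §3.
Pure composition of `NE7HintOfSliceNormalisationSU2Dec.hint_SU2_of_decomposition` (gen 95) with this generation's per-pair binder `NE7HdecompOfTopNormalised.hdecomp_body_of_topNormalised`
(all regime binders of the S4∕S5 files discharged at `d = 4`, `L = 2` from `ε ≤ ε₁` and the α̂-lines); `ε₀` shrinks to `min ε₀ ε₁` with `ε₁` the explicit positive minimum of §1.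

WHY.  After gen 98 (memo §0) the NE7 record reads `(8)∃ ⇐ hline ∧ hdecomp♭` and `hdecomp♭ ⇐ (A) ∧ (B)`; THIS FILE is the END in that form: `(8)∃ ⇐ hline ∧ hν ∧ hκ ∧ α̂-lines ∧ (A) ∧ (B)`.
(A) = S1 + S2 of ROAD-Γ′ ([Balaban1985RegularSpaces] Sects. D–E TYPE: the sup-normalised slice∕top-frame gauge; needs the slice sup letter (SL-∞), memo §2.7); (B) = the masses
(`m₂` from the S1 structure by Pythagoras, `p₂` by the block Poincaré inequality K6-Ξ, `m₁` by the Green's-function letter (G-ℓ¹) = dual of [Balaban1983RegularityDecay] (1.10)'s printed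
gradient member, memo §2).  Both are HYPOTHESES asserted for nothing.
WHAT ([folklore]; 0 def, 0 sorry).  §1 `eps1` lines (`eps_lines_of_le`: the five ε-lines of the per-pair binder from `ε ≤ ε₁`, `ε₁ > 0` explicit); §2 **`hint_SU2_of_topNormalised`**.
HONEST FRAMING (page 1): composition and real arithmetic over landed kernel theorems; nothing of Bałaban's asserted; (A), (B) and the numeric lines are hypotheses; NE7 NOT PROVED; spine 0∕9;
finite T⁴ rung (B)+1 — NOT infinite volume, NOT mass gap, NOT `BetaPertH`, NOT Clay.  Continuum YM on T⁴ ⇐ BetaPertH ∧ nine spine estimates (0/9 proved); BetaPertH ⇐ (D1) ∧ (D4) ∧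
CAP+tail; G-an2-4 gates asym, D1 and NE2/3/4.
-/

set_option autoImplicit false

open scoped BigOperators Matrix Matrix.Norms.L2Operator Topology
open NormedSpace Finset Set Filter

namespace Summit.QuantumFields.BalabanUV.T4Continuum.NE7HintOfTopNormalisedSU2

open Literature.MathematicalPhysics.QuantumFieldTheory.Balaban1983to89
open B7Prop1Explicit B7Prop2Explicit B7Prop3Flat MatrixLog UnitaryModel MatrixNorms
open T4AveragingDeficitWall (Ad IsUnitaryCfg IsSkewDir SmallField vary curl curlSq dirSq dirL1)
open T4AveragingDeficitWallBoundary (IsPeriodicCfg periodBox)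
open AveragingDeficitPeriodicCounting (IsPeriodicDir)
open AveragingDeficitMultiLevelPrep (LevelSmall tower TangentIter cavgIter)
open BlockAverageVaryHolo (nbRad)
open NE3CovariantLineSumsError (Csup Csup_nonneg)
open ShellMeasureAverageProp4General (C1cov C1cov_pos)
open MinimalActionLevels (perWin)
open MinimalActionSandwich (IsMinimiser admissible)
open MinimalActionRate (sfClass)
open NE3HessForm (dAction)
open NE3SlicePoincareBudgetLine (CPLine)
open NE3TangentCovariantTower (dirIter QbarIter framePotW)
open B7Eq92Concrete (vcov)
open NE3.PairLandauB8Avg (relPert)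
open BlockAveragePushDirGauge (gaugeDir)
open NE3CornerSpikes (spikeW)
open NE3QbarIterCovLiftPrep (cruxC)
open NE3SmoothRightInverseW (rightInvW)
open NE3RightInverseSolveLetters (thetaLoc thetaLoc_nonneg)
open NE3RightInverseL2Letter (l2C)
open NE3HatInvCurlLetters (curl2C curl1C)
open NE3EnergyShapes (IsUnitarySite IsPeriodicSite)
open NE3EnergyWeightedShapes (energyNormW)
open NE3FrameFreeSliceW (frameFreeBlockLandauW)
open NE7HintOfSliceNormalisationSU2Dec (hint_SU2_of_decomposition)
open NE7HdecompOfTopNormalised (hdecomp_body_of_topNormalised)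

noncomputable section

variable {n : Type} [Fintype n] [DecidableEq n]

/-! ## §1 The ε-lines of the per-pair binder from one explicit threshold -/

/-- The explicit threshold `ε₁ := min(10⁻¹¹, 1∕(2(thetaLoc+1)), 1∕(12·C0), c2'∕16, (3∕32)∕(C_{S1}+1))` is positive and every `0 < ε ≤ ε₁` meets the five ε-lines of
`NE7HdecompOfTopNormalised.hdecomp_body_of_topNormalised`. [folklore] -/
theorem eps_lines_of_le {ε : ℝ} (hε : 0 < ε)
    (hle : ε ≤ min (1 / 10 ^ 11) (min (1 / (2 * (thetaLoc 4 2 + 1))) (min (1 / (12 * C0 4)) (min (c2' 4 2 / 16)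
      ((3 / 32) / (16 * (((4 : ℕ) : ℝ) + 1) * (((4 : ℕ) : ℝ) + 4) * ((2 : ℕ) : ℝ) ^ 2 * Csup 4 2 * (((4 : ℕ) : ℝ) * (2 * ((nbRad 4 2 : ℕ) : ℝ) + 1) ^ 4) + 1)))))) :
    ε ≤ 1 / 10 ^ 11 ∧ thetaLoc 4 2 * ε < 1 ∧ C0 4 * (2 * (2 * ε)) ≤ 1 / 3 ∧ 4 * (2 * (2 * ε)) ≤ c2' 4 2 ∧
      16 * (((4 : ℕ) : ℝ) + 1) * (((4 : ℕ) : ℝ) + 4) * ((2 : ℕ) : ℝ) ^ 2 * Csup 4 2 * (((4 : ℕ) : ℝ) * (2 * ((nbRad 4 2 : ℕ) : ℝ) + 1) ^ 4) * (8 / 3 * (ε / 4))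
        ≤ ((2 : ℕ) : ℝ) / ((2 : ℕ) : ℝ) ^ 4 / 2 := by
  set CS : ℝ := 16 * (((4 : ℕ) : ℝ) + 1) * (((4 : ℕ) : ℝ) + 4) * ((2 : ℕ) : ℝ) ^ 2 * Csup 4 2 * (((4 : ℕ) : ℝ) * (2 * ((nbRad 4 2 : ℕ) : ℝ) + 1) ^ 4) with hCS
  have hCS0 : 0 ≤ CS := by rw [hCS]; have := Csup_nonneg 4 2; positivity
  have hθ0 : 0 ≤ thetaLoc 4 2 := thetaLoc_nonneg 4 2
  have hC0 : 0 < C0 4 := C0_pos 4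
  have h1 : ε ≤ 1 / 10 ^ 11 := hle.trans (min_le_left _ _)
  have h2 : ε ≤ 1 / (2 * (thetaLoc 4 2 + 1)) := hle.trans ((min_le_right _ _).trans (min_le_left _ _))
  have h3 : ε ≤ 1 / (12 * C0 4) := hle.trans ((min_le_right _ _).trans ((min_le_right _ _).trans (min_le_left _ _)))
  have h4 : ε ≤ c2' 4 2 / 16 := hle.trans ((min_le_right _ _).trans ((min_le_right _ _).trans ((min_le_right _ _).trans (min_le_left _ _))))
  have h5 : ε ≤ (3 / 32) / (CS + 1) := hle.trans ((min_le_right _ _).trans ((min_le_right _ _).trans ((min_le_right _ _).trans (min_le_right _ _))))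
  refine ⟨h1, ?_, ?_, ?_, ?_⟩
  · have h : thetaLoc 4 2 * ε ≤ thetaLoc 4 2 * (1 / (2 * (thetaLoc 4 2 + 1))) := mul_le_mul_of_nonneg_left h2 hθ0
    have h' : thetaLoc 4 2 * (1 / (2 * (thetaLoc 4 2 + 1))) < 1 := by
      rw [mul_one_div, div_lt_one (by positivity)]; linarith
    exact lt_of_le_of_lt h h'
  · have h : C0 4 * (2 * (2 * ε)) ≤ C0 4 * (2 * (2 * (1 / (12 * C0 4)))) := mul_le_mul_of_nonneg_left (by linarith) hC0.le
    have hC0' : C0 4 ≠ 0 := hC0.ne'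
    have e : C0 4 * (2 * (2 * (1 / (12 * C0 4)))) = 1 / 3 := by field_simp; ring
    linarith
  · linarith
  · have h : CS * (8 / 3 * (ε / 4)) ≤ CS * (8 / 3 * ((3 / 32) / (CS + 1) / 4)) :=
      mul_le_mul_of_nonneg_left (by linarith) hCS0
    have hCS1 : CS + 1 ≠ 0 := by positivity
    have h' : CS * (8 / 3 * ((3 / 32) / (CS + 1) / 4)) ≤ 1 / 16 := by
      rw [show CS * (8 / 3 * ((3 / 32) / (CS + 1) / 4)) = (1 / 16) * (CS / (CS + 1)) by field_simp; ring]
      have : CS / (CS + 1) ≤ 1 := by rw [div_le_one (by positivity)]; linarith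
      linarith
    have e : ((2 : ℕ) : ℝ) / ((2 : ℕ) : ℝ) ^ 4 / 2 = 1 / 16 := by norm_num
    rw [e]; exact h.trans h'

/-! ## §2 The END re-issued over ROAD-Γ′ -/

/-- **ROW NE7's END OF RECORD OVER ROAD-Γ′** (`d = 4`, `L = 2`, SU(2)): gen 95's `hint_SU2_of_decomposition` with the per-pair binder `hdecomp♭` REPLACED by
(A) for every admissible pair `(U_s, U′)` with `U_s` tangent-critical and every residual near-representative `u₀`, a TOP-NORMALISED representative: a unitary CORNER-TRIVIAL gauge `u` and a skew
`(N·M)`-periodic `X` with `U′^{u} = U_s·e^{X}`, `sup‖X‖ ≤ b`, `M·b ≤ α̂`, and trivial accumulated top frame `v_{k+1} ≡ 1` (ROAD-Γ′ S1 + S2); and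
(B) for every such representative, the three MASSES of every corner-trivial slice-correcting generator `μ` of the tangent residual `X − (spikes + rightInvW(D(X − spikes)))`:
`dirSq(gaugeDir U_s μ) ≤ m₂M²‖X‖_w²`, `Σ‖μ‖² ≤ p₂M⁴‖X‖_w²`, `Σ‖μ‖ ≤ m₁M³‖X‖_w²` with k-free `(m₂, p₂, m₁)`;
plus four explicit k-free lines on `α̂` and the two ceiling lines `ν(α̂, ε, m₂, p₂) ≤ ν̂`, `κ(ε, m₁) ≤ κ̂`.  CONCLUSION: gen 93's (8)∃ for `𝒰_k(2, ε)` in `d = 4`. [folklore] -/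
theorem hint_SU2_of_topNormalised [Nonempty n] (hn : Fintype.card n = 2) :
    ∃ ℓ : ℕ, 1 ≤ ℓ ∧ ∃ ε₀ : ℝ, 0 < ε₀ ∧ ∀ ε : ℝ, 0 < ε → ε ≤ ε₀ → ∃ β₀ : ℝ, 0 < β₀ ∧ ∀ β : ℝ, 0 < β → β ≤ β₀ →
    ∀ (N : ℕ) [NeZero N] (αh νh κh m₂ p₂ m₁ : ℝ), 1 ≤ N →
    -- gen 95's k-free strict line (F327)
    2 * κh < ((((1 / 2 - νh ^ 2) / (2 * (1 + (CPLine 4 2 2 (1 / 10 ^ 17) (1 / 10 ^ 53) + 1))) - νh ^ 2) / 2 - 576 * ((4 : ℕ) : ℝ) * (αh ^ 2 * Real.exp (2 * αh))) / (Fintype.card n : ℝ) - 28 * ((4 : ℕ) : ℝ) * (ε + 7 * αh ^ 2)) →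
    -- four k-free lines on `α̂`
    8 * (131072 * (((4 : ℕ) : ℝ) + 1) ^ 2) * αh ≤ 1 / 10 → 4 * αh ≤ c3 4 2 →
    16 * (C1cov 4 * ((2 : ℕ) : ℝ) ^ 2 * Real.sqrt (((4 : ℕ) : ℝ) * (2 * (2 * ((2 : ℕ) : ℝ)) + 1) ^ 4)) * αh ≤ Real.sqrt (((2 : ℕ) : ℝ) ^ 2 / ((2 : ℕ) : ℝ) ^ 4) →
    44 * (((4 : ℕ) : ℝ) * ((2 : ℕ) : ℝ) * αh) ≤ 1 →
    -- the masses are non-negative and meet the two ceiling lines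
    0 ≤ m₂ → 0 ≤ p₂ → 0 ≤ m₁ →
    2 * Real.sqrt (((Fintype.card (T4AveragingDeficitWall.Plane 4) : ℝ) + ((4 : ℕ) : ℝ))
            * (8192 * ((((4 : ℕ) : ℝ)) ^ 3 * ((2 : ℕ) : ℝ) ^ 5) * 2 + 2048 * ((((4 : ℕ) : ℝ)) * ((2 : ℕ) : ℝ)) * (C1cov 4 * ((2 : ℕ) : ℝ) ^ 2 * Real.sqrt (((4 : ℕ) : ℝ) * (2 * (2 * ((2 : ℕ) : ℝ)) + 1) ^ 4)) ^ 2 * 1))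
            * αh
          + Real.sqrt ((l2C 4 2 / (1 - thetaLoc 4 2 * ε) ^ 2 + curl2C 4 2 / (1 - thetaLoc 4 2 * ε) ^ 2)
              * (1024 * (C1cov 4 * ((2 : ℕ) : ℝ) ^ 2 * Real.sqrt (((4 : ℕ) : ℝ) * (2 * (2 * ((2 : ℕ) : ℝ)) + 1) ^ 4)) ^ 2 * (((2 : ℕ) : ℝ) ^ 4 / ((2 : ℕ) : ℝ) ^ 4))) * αh
          + Real.sqrt (4 * ε ^ 2 * (Fintype.card (T4AveragingDeficitWall.Plane 4)) * p₂ + m₂) ≤ νh →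
    2 * (Fintype.card (T4AveragingDeficitWall.Plane 4) : ℝ)
            * (16 * ((((4 : ℕ) : ℝ)) * ((2 : ℕ) : ℝ)) * (6 * 2 + 2 * (4 / 3)) + 64 * (C1cov 4 * ((2 : ℕ) : ℝ) ^ 2 * (((4 : ℕ) : ℝ) * (2 * (2 * ((2 : ℕ) : ℝ)) + 1) ^ 4)) * (4 / 3)) * ε ^ 2
          + (curl1C 4 2 / (1 - thetaLoc 4 2 * ε)) * ε * (64 * (C1cov 4 * ((2 : ℕ) : ℝ) ^ 2 * (((4 : ℕ) : ℝ) * (2 * (2 * ((2 : ℕ) : ℝ)) + 1) ^ 4)) * (((2 : ℕ) : ℝ) ^ 4 / ((2 : ℕ) : ℝ) ^ 2))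
          + 2 * (Fintype.card (T4AveragingDeficitWall.Plane 4)) * ε ^ 2 * m₁ ≤ κh →
    -- (A) THE TOP-NORMALISED REPRESENTATIVE OF EVERY ADMISSIBLE PAIR (ROAD-Γ′ S1 + S2)
    (∀ D : Site 4 → Fin 4 → (Matrix n n ℂ)ˣ, IsUnitaryCfg D → IsPeriodicCfg D (N : ℤ) → SmallField D (4 * (Real.exp β - 1)) → ∀ (k : ℕ), ∀ Us ∈ admissible (sfClass 4 2 N ε) 2 (k + 1) D, SmallField Us ((1 / ((2 : ℕ) : ℝ) ^ 2 * ε / 2) / (((2 : ℕ) : ℝ) ^ (k + 1)) ^ 2) → (∀ φ : Site 4 → Fin 4 → Matrix n n ℂ, IsSkewDir φ → IsPeriodicDir φ ((N * 2 ^ (k + 1) : ℕ) : ℤ) → TangentIter 2 k Us φ → dAction Us φ (perWin 4 (N * 2 ^ (k + 1))) = 0) → ∀ U' ∈ admissible (sfClass 4 2 N ε) 2 (k + 1) D,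
      ∀ u₀ : Site 4 → (Matrix n n ℂ)ˣ, IsUnitarySite u₀ → IsPeriodicSite u₀ ((N * 2 ^ (k + 1) : ℕ) : ℤ) → (∀ z : Site 4, u₀ (((2 ^ (k + 1) : ℕ) : ℤ) • z) = 1) →
        (∀ (x : Site 4) (μ : Fin 4), ‖(((Us x μ)⁻¹ * gaugeAct u₀ U' x μ : (Matrix n n ℂ)ˣ) : Matrix n n ℂ) - 1‖
          ≤ 10000000000000000000000000000000000 * (2 : ℝ) ^ (k + 1) * (ε / (((2 : ℕ) : ℝ) ^ (k + 1)) ^ 2)) →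
      ∃ (u : Site 4 → (Matrix n n ℂ)ˣ) (X : Site 4 → Fin 4 → Matrix n n ℂ) (b : ℝ),
        IsUnitarySite u ∧ (∀ z : Site 4, u ((((2 : ℕ) : ℤ) ^ (k + 1)) • z) = 1) ∧ IsSkewDir X ∧ IsPeriodicDir X ((N * 2 ^ (k + 1) : ℕ) : ℤ) ∧ 0 ≤ b ∧
        (∀ x μ, ‖X x μ‖ ≤ b) ∧ gaugeAct u U' = vary Us X 1 ∧ (∀ z : Site 4, vcov 2 Us (relPert Us X) (k + 1) z = 1) ∧ ((2 : ℕ) : ℝ) ^ (k + 1) * b ≤ αh) →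
    -- (B) THE THREE MASSES OF THE SLICE-CORRECTING GENERATOR OF THE TANGENT RESIDUAL (S1 structure + K6-Ξ + (G-ℓ¹))
    (∀ D : Site 4 → Fin 4 → (Matrix n n ℂ)ˣ, IsUnitaryCfg D → IsPeriodicCfg D (N : ℤ) → SmallField D (4 * (Real.exp β - 1)) → ∀ (k : ℕ), ∀ Us ∈ admissible (sfClass 4 2 N ε) 2 (k + 1) D, SmallField Us ((1 / ((2 : ℕ) : ℝ) ^ 2 * ε / 2) / (((2 : ℕ) : ℝ) ^ (k + 1)) ^ 2) → (∀ φ : Site 4 → Fin 4 → Matrix n n ℂ, IsSkewDir φ → IsPeriodicDir φ ((N * 2 ^ (k + 1) : ℕ) : ℤ) → TangentIter 2 k Us φ → dAction Us φ (perWin 4 (N * 2 ^ (k + 1))) = 0) → ∀ U' ∈ admissible (sfClass 4 2 N ε) 2 (k + 1) D,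
      ∀ (u : Site 4 → (Matrix n n ℂ)ˣ) (X : Site 4 → Fin 4 → Matrix n n ℂ) (b : ℝ),
        IsUnitarySite u → (∀ z : Site 4, u ((((2 : ℕ) : ℤ) ^ (k + 1)) • z) = 1) → IsSkewDir X → IsPeriodicDir X ((N * 2 ^ (k + 1) : ℕ) : ℤ) → 0 ≤ b →
        (∀ x μ, ‖X x μ‖ ≤ b) → gaugeAct u U' = vary Us X 1 → (∀ z : Site 4, vcov 2 Us (relPert Us X) (k + 1) z = 1) → ((2 : ℕ) : ℝ) ^ (k + 1) * b ≤ αh →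
      ∀ (hWu : IsUnitaryCfg Us) (hWx : SmallField Us (ε / (((2 : ℕ) : ℝ) ^ (k + 1)) ^ 2)) (hx0 : 0 ≤ ε / (((2 : ℕ) : ℝ) ^ (k + 1)) ^ 2)
        (hsm0 : LevelSmall 4 2 k (ε / (((2 : ℕ) : ℝ) ^ (k + 1)) ^ 2)) (hθ0 : cruxC 4 2 * ((((2 : ℕ) : ℝ) ^ (k + 1)) ^ 2 * (ε / (((2 : ℕ) : ℝ) ^ (k + 1)) ^ 2)) < 1)
        (hYs : IsSkewDir (dirIter 2 (k + 1) Us (fun y ν => X y ν - gaugeDir Us (spikeW (2 ^ (k + 1)) (framePotW 2 (k + 1) Us X)) y ν)))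
        (mu : Site 4 → Matrix n n ℂ), (∀ y, mu y ∈ skewAdjoint (Matrix n n ℂ)) →
        (∀ (y : Site 4) (i : Fin 4), mu (y + ((N * 2 ^ (k + 1) : ℕ) : ℤ) • e i) = mu y) → (∀ w : Site 4, mu ((((2 : ℕ) : ℤ) ^ (k + 1)) • w) = 0) →
        (fun y ν => (X y ν - (gaugeDir Us (spikeW (2 ^ (k + 1)) (framePotW 2 (k + 1) Us X)) + rightInvW (le_refl 2) k hWu hx0 hsm0 hWx N hθ0 hYs) y ν) + gaugeDir Us mu y ν)
          ∈ frameFreeBlockLandauW (d := 4) (n := n) 2 N (k + 1) Us →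
        dirSq (gaugeDir Us mu) (periodBox (d := 4) (N * 2 ^ (k + 1))) ≤ m₂ * (((2 : ℕ) : ℝ) ^ (k + 1)) ^ 2 * energyNormW 2 (k + 1) Us X (periodBox (d := 4) (N * 2 ^ (k + 1))) ^ 2
        ∧ ∑ z ∈ periodBox (d := 4) (N * 2 ^ (k + 1)), ‖mu z‖ ^ 2 ≤ p₂ * (((2 : ℕ) : ℝ) ^ (k + 1)) ^ 4 * energyNormW 2 (k + 1) Us X (periodBox (d := 4) (N * 2 ^ (k + 1))) ^ 2
        ∧ ∑ z ∈ periodBox (d := 4) (N * 2 ^ (k + 1)), ‖mu z‖ ≤ m₁ * (((2 : ℕ) : ℝ) ^ (k + 1)) ^ 3 * energyNormW 2 (k + 1) Us X (periodBox (d := 4) (N * 2 ^ (k + 1))) ^ 2) →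
    ∃ δV : ℝ, 0 < δV ∧
      ∀ V ∈ {V : Site 4 → Fin 4 → (Matrix n n ℂ)ˣ | IsUnitaryCfg V ∧ IsPeriodicCfg V (N : ℤ) ∧ SmallField V δV},
      ∀ k : ℕ, ∃ U : Site 4 → Fin 4 → (Matrix n n ℂ)ˣ, IsMinimiser 4 (sfClass 4 2 N ε) 2 N k V U ∧
        ∃ a : ℝ, 0 ≤ a ∧ a < ε / (((2 : ℕ) : ℝ) ^ k) ^ 2 ∧ SmallField U a := by
  obtain ⟨ℓ, hℓ1, ε₀, hε₀, H⟩ := hint_SU2_of_decomposition (n := n) hn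
  set ε₁ : ℝ := min (1 / 10 ^ 11) (min (1 / (2 * (thetaLoc 4 2 + 1))) (min (1 / (12 * C0 4)) (min (c2' 4 2 / 16)
      ((3 / 32) / (16 * (((4 : ℕ) : ℝ) + 1) * (((4 : ℕ) : ℝ) + 4) * ((2 : ℕ) : ℝ) ^ 2 * Csup 4 2 * (((4 : ℕ) : ℝ) * (2 * ((nbRad 4 2 : ℕ) : ℝ) + 1) ^ 4) + 1))))) with hε₁
  have hε₁0 : 0 < ε₁ := by
    have hθ0 : 0 ≤ thetaLoc 4 2 := thetaLoc_nonneg 4 2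
    have hC0 : 0 < C0 4 := C0_pos 4
    have hc2 : 0 < c2' 4 2 := c2'_pos 4 2 (by norm_num)
    have hCS : 0 ≤ 16 * (((4 : ℕ) : ℝ) + 1) * (((4 : ℕ) : ℝ) + 4) * ((2 : ℕ) : ℝ) ^ 2 * Csup 4 2 * (((4 : ℕ) : ℝ) * (2 * ((nbRad 4 2 : ℕ) : ℝ) + 1) ^ 4) := by
      have := Csup_nonneg 4 2; positivity
    rw [hε₁]
    refine lt_min (by norm_num) (lt_min (by positivity) (lt_min (by positivity) (lt_min (by positivity) (by positivity))))
  refine ⟨ℓ, hℓ1, min ε₀ ε₁, lt_min hε₀ hε₁0, fun ε hε hεle => ?_⟩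
  obtain ⟨β₀, hβ₀, H2⟩ := H ε hε (hεle.trans (min_le_left _ _))
  refine ⟨β₀, hβ₀, fun β hβ hβle N _ αh νh κh m₂ p₂ m₁ hN hline hαh1 hαh2 hαh3 hαh4 hm₂ hp₂ hm₁ hνh hκh hA hB => ?_⟩
  obtain ⟨hε11, hεθ, hεC0, hεc2, hεS1⟩ := eps_lines_of_le hε (hεle.trans (min_le_right _ _))
  refine H2 β hβ hβle N αh νh κh hN hline ?_
  intro D hD hDP hDS k Us hUs hUsS hcrit U' hU' u₀ hu₀U hu₀P hu₀pin hu₀err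
  -- class data of the pair
  have hUs' : IsUnitaryCfg Us ∧ IsPeriodicCfg Us ((N * 2 ^ (k + 1) : ℕ) : ℤ) ∧ SmallField Us (ε / (((2 : ℕ) : ℝ) ^ (k + 1)) ^ 2) := hUs.1
  have hWav : avgIter 2 Us (k + 1) = D := hUs.2
  have hAav : avgIter 2 U' (k + 1) = D := hU'.2
  -- (A): the top-normalised representative
  obtain ⟨u, X, b, hu, hcorner, hXs, hXP, hb, hX, hrep, hv1, hbα⟩ := hA D hD hDP hDS k Us hUs hUsS hcrit U' hU' u₀ hu₀U hu₀P hu₀pin hu₀err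
  -- (B): the masses, for this representative
  have hμ := hB D hD hDP hDS k Us hUs hUsS hcrit U' hU' u X b hu hcorner hXs hXP hb hX hrep hv1 hbα hUs'.1 hUs'.2.2
  exact hdecomp_body_of_topNormalised (N := N) hN k hε hε11 hεθ hεC0 hεc2 hεS1 hUs'.1 hUs'.2.1 hUs'.2.2 hAav hWav hαh1 hαh2 hαh3 hαh4
    hu hcorner hXs hXP hb hX hrep hv1 hbα hm₂ hp₂ hm₁ (fun hx0 hsm0 hθ0 hYs mu h1 h2 h3 h4 => hμ hx0 hsm0 hθ0 hYs mu h1 h2 h3 h4) hνh hκh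

/-! ## §3 ERRATUM AND THE END OF RECORD: the representative and its masses in ONE per-pair hypothesis -/

/-- **ROW NE7's END OF RECORD OVER ROAD-Γ′ (S2 currency) — MERGED FORM.**  In `hint_SU2_of_topNormalised` the masses (B) are asked of EVERY top-normalised representative
`(u, X, b)`; but the `m₁`-line `Σ_z‖μ(z)‖ ≤ m₁·M³·‖X‖_w²` is INHOMOGENEOUS (linear left, quadratic right) and FAILS for the pure-gauge dipole representatives
`X_t = t·D_{U_s}λ` (`λ` on two non-corner sites of one block, covariant block mean zero — a corner-trivial gauge with `v_{k+1} ≡ 1`; `t ↓ 0`) of the trivial pair `(U_s, U_s)`: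
`μ = −tλ` is an admissible slice-correcting generator with `Σ‖μ‖ = 2t‖λ₀‖` while `‖X_t‖_w² = O(t²)` (memo ROAD-G98 §3.2).  So (B) as a SEPARATE universally quantified hypothesis
is not dischargeable, and the END of record in S2's currency is THIS form: per admissible pair ONE top-normalised representative (the one S1 + S2 constructs, slice-Landau up to the
BCH residue) carrying the three MASSES of every corner-trivial slice-correcting generator of ITS tangent residual; gen 95's line, the four `α̂`-lines and the two ceiling lines unchanged.
Proof: gen 95's `hint_SU2_of_decomposition` + `NE7HdecompOfTopNormalised.hdecomp_body_of_topNormalised`. [folklore] -/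
theorem hint_SU2_of_topNormalised' [Nonempty n] (hn : Fintype.card n = 2) :
    ∃ ℓ : ℕ, 1 ≤ ℓ ∧ ∃ ε₀ : ℝ, 0 < ε₀ ∧ ∀ ε : ℝ, 0 < ε → ε ≤ ε₀ → ∃ β₀ : ℝ, 0 < β₀ ∧ ∀ β : ℝ, 0 < β → β ≤ β₀ →
    ∀ (N : ℕ) [NeZero N] (αh νh κh m₂ p₂ m₁ : ℝ), 1 ≤ N →
    -- gen 95's k-free strict line (F327)
    2 * κh < ((((1 / 2 - νh ^ 2) / (2 * (1 + (CPLine 4 2 2 (1 / 10 ^ 17) (1 / 10 ^ 53) + 1))) - νh ^ 2) / 2 - 576 * ((4 : ℕ) : ℝ) * (αh ^ 2 * Real.exp (2 * αh))) / (Fintype.card n : ℝ) - 28 * ((4 : ℕ) : ℝ) * (ε + 7 * αh ^ 2)) →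
    -- four k-free lines on `α̂`
    8 * (131072 * (((4 : ℕ) : ℝ) + 1) ^ 2) * αh ≤ 1 / 10 → 4 * αh ≤ c3 4 2 →
    16 * (C1cov 4 * ((2 : ℕ) : ℝ) ^ 2 * Real.sqrt (((4 : ℕ) : ℝ) * (2 * (2 * ((2 : ℕ) : ℝ)) + 1) ^ 4)) * αh ≤ Real.sqrt (((2 : ℕ) : ℝ) ^ 2 / ((2 : ℕ) : ℝ) ^ 4) →
    44 * (((4 : ℕ) : ℝ) * ((2 : ℕ) : ℝ) * αh) ≤ 1 →
    -- the masses are non-negative and meet the two ceiling lines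
    0 ≤ m₂ → 0 ≤ p₂ → 0 ≤ m₁ →
    2 * Real.sqrt (((Fintype.card (T4AveragingDeficitWall.Plane 4) : ℝ) + ((4 : ℕ) : ℝ))
            * (8192 * ((((4 : ℕ) : ℝ)) ^ 3 * ((2 : ℕ) : ℝ) ^ 5) * 2 + 2048 * ((((4 : ℕ) : ℝ)) * ((2 : ℕ) : ℝ)) * (C1cov 4 * ((2 : ℕ) : ℝ) ^ 2 * Real.sqrt (((4 : ℕ) : ℝ) * (2 * (2 * ((2 : ℕ) : ℝ)) + 1) ^ 4)) ^ 2 * 1))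
            * αh
          + Real.sqrt ((l2C 4 2 / (1 - thetaLoc 4 2 * ε) ^ 2 + curl2C 4 2 / (1 - thetaLoc 4 2 * ε) ^ 2)
              * (1024 * (C1cov 4 * ((2 : ℕ) : ℝ) ^ 2 * Real.sqrt (((4 : ℕ) : ℝ) * (2 * (2 * ((2 : ℕ) : ℝ)) + 1) ^ 4)) ^ 2 * (((2 : ℕ) : ℝ) ^ 4 / ((2 : ℕ) : ℝ) ^ 4))) * αh
          + Real.sqrt (4 * ε ^ 2 * (Fintype.card (T4AveragingDeficitWall.Plane 4)) * p₂ + m₂) ≤ νh →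
    2 * (Fintype.card (T4AveragingDeficitWall.Plane 4) : ℝ)
            * (16 * ((((4 : ℕ) : ℝ)) * ((2 : ℕ) : ℝ)) * (6 * 2 + 2 * (4 / 3)) + 64 * (C1cov 4 * ((2 : ℕ) : ℝ) ^ 2 * (((4 : ℕ) : ℝ) * (2 * (2 * ((2 : ℕ) : ℝ)) + 1) ^ 4)) * (4 / 3)) * ε ^ 2
          + (curl1C 4 2 / (1 - thetaLoc 4 2 * ε)) * ε * (64 * (C1cov 4 * ((2 : ℕ) : ℝ) ^ 2 * (((4 : ℕ) : ℝ) * (2 * (2 * ((2 : ℕ) : ℝ)) + 1) ^ 4)) * (((2 : ℕ) : ℝ) ^ 4 / ((2 : ℕ) : ℝ) ^ 2))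
          + 2 * (Fintype.card (T4AveragingDeficitWall.Plane 4)) * ε ^ 2 * m₁ ≤ κh →
    -- (AB) PER PAIR, ONE TOP-NORMALISED REPRESENTATIVE CARRYING THE THREE SLICE MASSES (ROAD-Γ′ S1 + S2 + masses)
    (∀ D : Site 4 → Fin 4 → (Matrix n n ℂ)ˣ, IsUnitaryCfg D → IsPeriodicCfg D (N : ℤ) → SmallField D (4 * (Real.exp β - 1)) → ∀ (k : ℕ), ∀ Us ∈ admissible (sfClass 4 2 N ε) 2 (k + 1) D, SmallField Us ((1 / ((2 : ℕ) : ℝ) ^ 2 * ε / 2) / (((2 : ℕ) : ℝ) ^ (k + 1)) ^ 2) → (∀ φ : Site 4 → Fin 4 → Matrix n n ℂ, IsSkewDir φ → IsPeriodicDir φ ((N * 2 ^ (k + 1) : ℕ) : ℤ) → TangentIter 2 k Us φ → dAction Us φ (perWin 4 (N * 2 ^ (k + 1))) = 0) → ∀ U' ∈ admissible (sfClass 4 2 N ε) 2 (k + 1) D,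
      ∀ u₀ : Site 4 → (Matrix n n ℂ)ˣ, IsUnitarySite u₀ → IsPeriodicSite u₀ ((N * 2 ^ (k + 1) : ℕ) : ℤ) → (∀ z : Site 4, u₀ (((2 ^ (k + 1) : ℕ) : ℤ) • z) = 1) →
        (∀ (x : Site 4) (μ : Fin 4), ‖(((Us x μ)⁻¹ * gaugeAct u₀ U' x μ : (Matrix n n ℂ)ˣ) : Matrix n n ℂ) - 1‖
          ≤ 10000000000000000000000000000000000 * (2 : ℝ) ^ (k + 1) * (ε / (((2 : ℕ) : ℝ) ^ (k + 1)) ^ 2)) →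
      ∃ (u : Site 4 → (Matrix n n ℂ)ˣ) (X : Site 4 → Fin 4 → Matrix n n ℂ) (b : ℝ),
        IsUnitarySite u ∧ (∀ z : Site 4, u ((((2 : ℕ) : ℤ) ^ (k + 1)) • z) = 1) ∧ IsSkewDir X ∧ IsPeriodicDir X ((N * 2 ^ (k + 1) : ℕ) : ℤ) ∧ 0 ≤ b ∧
        (∀ x μ, ‖X x μ‖ ≤ b) ∧ gaugeAct u U' = vary Us X 1 ∧ (∀ z : Site 4, vcov 2 Us (relPert Us X) (k + 1) z = 1) ∧ ((2 : ℕ) : ℝ) ^ (k + 1) * b ≤ αh ∧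
      ∀ (hWu : IsUnitaryCfg Us) (hWx : SmallField Us (ε / (((2 : ℕ) : ℝ) ^ (k + 1)) ^ 2)) (hx0 : 0 ≤ ε / (((2 : ℕ) : ℝ) ^ (k + 1)) ^ 2)
        (hsm0 : LevelSmall 4 2 k (ε / (((2 : ℕ) : ℝ) ^ (k + 1)) ^ 2)) (hθ0 : cruxC 4 2 * ((((2 : ℕ) : ℝ) ^ (k + 1)) ^ 2 * (ε / (((2 : ℕ) : ℝ) ^ (k + 1)) ^ 2)) < 1)
        (hYs : IsSkewDir (dirIter 2 (k + 1) Us (fun y ν => X y ν - gaugeDir Us (spikeW (2 ^ (k + 1)) (framePotW 2 (k + 1) Us X)) y ν)))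
        (mu : Site 4 → Matrix n n ℂ), (∀ y, mu y ∈ skewAdjoint (Matrix n n ℂ)) →
        (∀ (y : Site 4) (i : Fin 4), mu (y + ((N * 2 ^ (k + 1) : ℕ) : ℤ) • e i) = mu y) → (∀ w : Site 4, mu ((((2 : ℕ) : ℤ) ^ (k + 1)) • w) = 0) →
        (fun y ν => (X y ν - (gaugeDir Us (spikeW (2 ^ (k + 1)) (framePotW 2 (k + 1) Us X)) + rightInvW (le_refl 2) k hWu hx0 hsm0 hWx N hθ0 hYs) y ν) + gaugeDir Us mu y ν)
          ∈ frameFreeBlockLandauW (d := 4) (n := n) 2 N (k + 1) Us →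
        dirSq (gaugeDir Us mu) (periodBox (d := 4) (N * 2 ^ (k + 1))) ≤ m₂ * (((2 : ℕ) : ℝ) ^ (k + 1)) ^ 2 * energyNormW 2 (k + 1) Us X (periodBox (d := 4) (N * 2 ^ (k + 1))) ^ 2
        ∧ ∑ z ∈ periodBox (d := 4) (N * 2 ^ (k + 1)), ‖mu z‖ ^ 2 ≤ p₂ * (((2 : ℕ) : ℝ) ^ (k + 1)) ^ 4 * energyNormW 2 (k + 1) Us X (periodBox (d := 4) (N * 2 ^ (k + 1))) ^ 2
        ∧ ∑ z ∈ periodBox (d := 4) (N * 2 ^ (k + 1)), ‖mu z‖ ≤ m₁ * (((2 : ℕ) : ℝ) ^ (k + 1)) ^ 3 * energyNormW 2 (k + 1) Us X (periodBox (d := 4) (N * 2 ^ (k + 1))) ^ 2) →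
    ∃ δV : ℝ, 0 < δV ∧
      ∀ V ∈ {V : Site 4 → Fin 4 → (Matrix n n ℂ)ˣ | IsUnitaryCfg V ∧ IsPeriodicCfg V (N : ℤ) ∧ SmallField V δV},
      ∀ k : ℕ, ∃ U : Site 4 → Fin 4 → (Matrix n n ℂ)ˣ, IsMinimiser 4 (sfClass 4 2 N ε) 2 N k V U ∧
        ∃ a : ℝ, 0 ≤ a ∧ a < ε / (((2 : ℕ) : ℝ) ^ k) ^ 2 ∧ SmallField U a := by
  obtain ⟨ℓ, hℓ1, ε₀, hε₀, H⟩ := hint_SU2_of_decomposition (n := n) hn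
  set ε₁ : ℝ := min (1 / 10 ^ 11) (min (1 / (2 * (thetaLoc 4 2 + 1))) (min (1 / (12 * C0 4)) (min (c2' 4 2 / 16)
      ((3 / 32) / (16 * (((4 : ℕ) : ℝ) + 1) * (((4 : ℕ) : ℝ) + 4) * ((2 : ℕ) : ℝ) ^ 2 * Csup 4 2 * (((4 : ℕ) : ℝ) * (2 * ((nbRad 4 2 : ℕ) : ℝ) + 1) ^ 4) + 1))))) with hε₁
  have hε₁0 : 0 < ε₁ := by
    have hθ0 : 0 ≤ thetaLoc 4 2 := thetaLoc_nonneg 4 2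
    have hC0 : 0 < C0 4 := C0_pos 4
    have hc2 : 0 < c2' 4 2 := c2'_pos 4 2 (by norm_num)
    have hCS : 0 ≤ 16 * (((4 : ℕ) : ℝ) + 1) * (((4 : ℕ) : ℝ) + 4) * ((2 : ℕ) : ℝ) ^ 2 * Csup 4 2 * (((4 : ℕ) : ℝ) * (2 * ((nbRad 4 2 : ℕ) : ℝ) + 1) ^ 4) := by
      have := Csup_nonneg 4 2; positivity
    rw [hε₁]
    refine lt_min (by norm_num) (lt_min (by positivity) (lt_min (by positivity) (lt_min (by positivity) (by positivity))))
  refine ⟨ℓ, hℓ1, min ε₀ ε₁, lt_min hε₀ hε₁0, fun ε hε hεle => ?_⟩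
  obtain ⟨β₀, hβ₀, H2⟩ := H ε hε (hεle.trans (min_le_left _ _))
  refine ⟨β₀, hβ₀, fun β hβ hβle N _ αh νh κh m₂ p₂ m₁ hN hline hαh1 hαh2 hαh3 hαh4 hm₂ hp₂ hm₁ hνh hκh hAB => ?_⟩
  obtain ⟨hε11, hεθ, hεC0, hεc2, hεS1⟩ := eps_lines_of_le hε (hεle.trans (min_le_right _ _))
  refine H2 β hβ hβle N αh νh κh hN hline ?_
  intro D hD hDP hDS k Us hUs hUsS hcrit U' hU' u₀ hu₀U hu₀P hu₀pin hu₀err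
  -- class data of the pair
  have hUs' : IsUnitaryCfg Us ∧ IsPeriodicCfg Us ((N * 2 ^ (k + 1) : ℕ) : ℤ) ∧ SmallField Us (ε / (((2 : ℕ) : ℝ) ^ (k + 1)) ^ 2) := hUs.1
  have hWav : avgIter 2 Us (k + 1) = D := hUs.2
  have hAav : avgIter 2 U' (k + 1) = D := hU'.2
  -- (AB): the top-normalised representative together with its masses
  obtain ⟨u, X, b, hu, hcorner, hXs, hXP, hb, hX, hrep, hv1, hbα, hμ0⟩ := hAB D hD hDP hDS k Us hUs hUsS hcrit U' hU' u₀ hu₀U hu₀P hu₀pin hu₀err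
  have hμ := hμ0 hUs'.1 hUs'.2.2
  exact hdecomp_body_of_topNormalised (N := N) hN k hε hε11 hεθ hεC0 hεc2 hεS1 hUs'.1 hUs'.2.1 hUs'.2.2 hAav hWav hαh1 hαh2 hαh3 hαh4
    hu hcorner hXs hXP hb hX hrep hv1 hbα hm₂ hp₂ hm₁ (fun hx0 hsm0 hθ0 hYs mu h1 h2 h3 h4 => hμ hx0 hsm0 hθ0 hYs mu h1 h2 h3 h4) hνh hκh

end

end Summit.QuantumFields.BalabanUV.T4Continuum.NE7HintOfTopNormalisedSU2
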